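import Summits.HubbardSuperconductivity.HubbardSuperconductivity.Theorems.AposterioriCapRgSeededBrokenRegimeBoseFermiPinnedSeedSliceBound

/-!
# The seeded CT covariance above scale is differentiable in the seed strength

Support for the seed flow equation (Polchinski) of crux stmt-HubbardSuperconductivity-14047, line
`polchinski-seed-flow`: every entry of `h ↦ C^{K}_{>Λ,h} = hubbardCovAboveCT L M β μ h K Λ` is
differentiable in the seed strength `h`.  The symmetrised Salmhofer weight `½(w(k_X) + w(k_Y))` is
`h`-free; if it vanishes the entry is identically `0`, otherwise one weight is nonzero, which forces that
momentum above half scale (`χ₂ = 0` on `[0, ¼]`), where S1 (`stub_seedSliceBound` at scale `Λ/2`) gives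
differentiability of the Nambu propagator entries; the Kronecker delta of `nambuTwoPointCT` and the
invariance of `ω² + e_K²` under the Nambu relabelling `toNambu` transport the half-scale condition.
-/

set_option linter.dupNamespace false -- `Summit.<S>.<S>` doubles the summit name (tree convention)

namespace Summit.HubbardSuperconductivity.HubbardSuperconductivity.Theorems.AposterioriCapRgSeededBrokenRegimeBoseFermiPinned

open Literature.MathematicalPhysics.QuantumLattice Literature.Probability.LatticeModels GrassmannAlgebra

/-- If the weight of a momentum above scale `Λ > 0` does not vanish, the momentum lies above `Λ/2`:
`(Λ/2)² ≤ ω² + e_K²` (contrapositive of `χ₂ = 0` on `[0, ¼]`). [folklore] -/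
theorem seedCov_sq_half_le_of_weight_ne_zero {L M : ℕ} {β μ Λ : ℝ} {K : TrigPolyC4v} (hΛ : 0 < Λ)
    {k : FreqMomentum L M} (hw : hubbardCutoffWeightCT L M β μ K Λ k ≠ 0) :
    (Λ / 2) ^ 2 ≤ matsubaraFreq β M k.1 ^ 2 + nambuXiCT L μ K k.2 ^ 2 := by
  by_contra hlt
  push Not at hlt
  apply hw
  rw [hubbardCutoffWeightCT]
  apply salmhoferCutoff_of_le
  rw [div_le_iff₀ (by positivity)]
  nlinarith [hlt]

/-- The Nambu relabelling replaces `k` by `±k`, which does not change `ω² + e_K²`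
(`ω_{rev i} = -ω_i`, `e_K(-k⃗) = e_K(k⃗)`). [folklore] -/
theorem seedCov_den_toNambu {L M : ℕ} [NeZero L] (β μ : ℝ) (K : TrigPolyC4v) (X : HubbardFieldIdx L M) :
    matsubaraFreq β M (toNambu X).1.1.1 ^ 2 + nambuXiCT L μ K (toNambu X).1.1.2 ^ 2 =
      matsubaraFreq β M (momentumOf L M X).1 ^ 2 + nambuXiCT L μ K (momentumOf L M X).2 ^ 2 := by
  unfold toNambu momentumOf
  split_ifs
  · rfl
  · simp only [FreqMomentum.neg, matsubaraFreq_rev, neg_sq, nambuXiCT_neg]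

/-- One ordered Nambu two-point term is differentiable in the seed as soon as one of its two Nambu
momenta lies above `Λ/2` (the Kronecker delta forces the momenta to agree; S1 at scale `Λ/2`).
[folklore] -/
theorem differentiableAt_nambuTwoPointCT_seed {L M : ℕ} [NeZero L] {β μ Λ : ℝ} {K : TrigPolyC4v}
    (hΛ : 0 < Λ) (A B : (FreqMomentum L M × Fin 2) × Fin 2)
    (hAB : (Λ / 2) ^ 2 ≤ matsubaraFreq β M A.1.1.1 ^ 2 + nambuXiCT L μ K A.1.1.2 ^ 2 ∨
      (Λ / 2) ^ 2 ≤ matsubaraFreq β M B.1.1.1 ^ 2 + nambuXiCT L μ K B.1.1.2 ^ 2)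
    (x : ℝ) :
    DifferentiableAt ℝ (fun h' : ℝ => nambuTwoPointCT L M β μ h' K A B) x := by
  unfold nambuTwoPointCT
  by_cases hc : A.2 = 1 ∧ B.2 = 0 ∧ A.1.1 = B.1.1
  · have hk : A.1.1 = B.1.1 := hc.2.2
    have hD : (Λ / 2) ^ 2 ≤ matsubaraFreq β M A.1.1.1 ^ 2 + nambuXiCT L μ K A.1.1.2 ^ 2 := by
      rcases hAB with hA | hB
      · exact hA
      · rw [hk]; exact hB
    simp only [if_pos hc]
    exact (stub_seedSliceBound L M β μ (Λ / 2) x K A.1.1 A.1.2 B.1.2 (by positivity) hD).1.const_mul _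
  · simp only [if_neg hc]
    exact differentiableAt_const _

/-- The antisymmetrised two-point entry `⟨ψ_X ψ_Y⟩₀^K` is differentiable in the seed as soon as one
of the momenta `k_X`, `k_Y` has nonzero weight above `Λ`. [folklore] -/
theorem differentiableAt_hubbardTwoPointCT_seed {L M : ℕ} [NeZero L] {β μ Λ : ℝ} {K : TrigPolyC4v}
    (hΛ : 0 < Λ) (X Y : HubbardFieldIdx L M)
    (hXY : hubbardCutoffWeightCT L M β μ K Λ (momentumOf L M X) ≠ 0 ∨
      hubbardCutoffWeightCT L M β μ K Λ (momentumOf L M Y) ≠ 0)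
    (x : ℝ) :
    DifferentiableAt ℝ (fun h' : ℝ => hubbardTwoPointCT L M β μ h' K X Y) x := by
  have hAB : (Λ / 2) ^ 2 ≤ matsubaraFreq β M (toNambu X).1.1.1 ^ 2 + nambuXiCT L μ K (toNambu X).1.1.2 ^ 2 ∨
      (Λ / 2) ^ 2 ≤ matsubaraFreq β M (toNambu Y).1.1.1 ^ 2 + nambuXiCT L μ K (toNambu Y).1.1.2 ^ 2 := by
    rcases hXY with hx | hy
    · left
      rw [seedCov_den_toNambu]
      exact seedCov_sq_half_le_of_weight_ne_zero hΛ hx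
    · right
      rw [seedCov_den_toNambu]
      exact seedCov_sq_half_le_of_weight_ne_zero hΛ hy
  unfold hubbardTwoPointCT
  exact (differentiableAt_nambuTwoPointCT_seed hΛ (toNambu X) (toNambu Y) hAB x).sub
    (differentiableAt_nambuTwoPointCT_seed hΛ (toNambu Y) (toNambu X) hAB.symm x)

/-- Every entry of the CT covariance above scale `Λ > 0` is differentiable in the seed strength: the
symmetrised weight is `h`-free, and either vanishes (constant entry) or puts a momentum above `Λ/2`.
[folklore] -/
theorem differentiableAt_hubbardCovAboveCT_seed {L M : ℕ} [NeZero L] (β μ : ℝ) (K : TrigPolyC4v) {Λ : ℝ}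
    (hΛ : 0 < Λ) (X Y : HubbardFieldIdx L M) (x : ℝ) :
    DifferentiableAt ℝ (fun h' : ℝ => hubbardCovAboveCT L M β μ h' K Λ X Y) x := by
  simp only [hubbardCovAboveCT, hubbardCovarianceCT, Matrix.of_apply]
  by_cases hc : hubbardCutoffWeightCT L M β μ K Λ (momentumOf L M X) = 0 ∧
      hubbardCutoffWeightCT L M β μ K Λ (momentumOf L M Y) = 0
  · simp only [hc.1, hc.2, add_zero, zero_div, Complex.ofReal_zero, zero_mul]
    exact differentiableAt_const _
  · have hXY : hubbardCutoffWeightCT L M β μ K Λ (momentumOf L M X) ≠ 0 ∨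
        hubbardCutoffWeightCT L M β μ K Λ (momentumOf L M Y) ≠ 0 := by
      by_contra hne
      push Not at hne
      exact hc hne
    exact (differentiableAt_hubbardTwoPointCT_seed hΛ X Y hXY x).neg.const_mul _

/-- **W2 (`hasDerivAt_hubbardCovAboveCT_seed`)**: the covariance path `h ↦ C^{K}_{>Λ,h}(X,Y)` of the
seed flow is differentiable entrywise in the seed strength, i.e. has derivative `deriv (·) h` at every
`h` (`0 < Λ`; the hypothesis `0 < β` is not needed). [folklore] -/
theorem hasDerivAt_hubbardCovAboveCT_seed :
    ∀ (L M : ℕ) [NeZero L] (β μ h : ℝ) (K : TrigPolyC4v) (Λ : ℝ) (X Y : HubbardFieldIdx L M), 0 < β → 0 < Λ →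
      HasDerivAt (fun h' : ℝ => hubbardCovAboveCT L M β μ h' K Λ X Y)
        (deriv (fun h' : ℝ => hubbardCovAboveCT L M β μ h' K Λ X Y) h) h := by
  intro L M _ β μ h K Λ X Y _ hΛ
  exact (differentiableAt_hubbardCovAboveCT_seed β μ K hΛ X Y h).hasDerivAt

end Summit.HubbardSuperconductivity.HubbardSuperconductivity.Theorems.AposterioriCapRgSeededBrokenRegimeBoseFermiPinned
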